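import Summits.QuantumFields.YangMills.Theorems.LuscherReductionTwistedTraceScalingBTRatesBudget
import HarnessLib

/-!
# (B-T) FOR AN ARBITRARY PROFILE, part 3: the exponential budgets (H1)–(H3) on SCHEDULE B (`r ≤ β^{-1/2}ℓ`, `α = β^{-1/2}ℓ²`, `R₁ = 5β^{-1/2}ℓ²`)
# (lane A of S-BASE, crux `TwistedTraceScaling` stmt-QuantumFields-20203, C4-CORE, the (B-T) pen; design note `pub/ym-fleet/ym-luscher-20007-p1/COARSE-DESIGN.md` §26)

With the fibre radius inflated to `β^{-1/2}·log β` the tail exponent `βM₀` grows like `log²β`; the near/far thresholds `α = β^{-1/2}log²β`, `R₁ = 5α` make the defect masses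
grow like `log⁴β`, which wins:
* `eventually_exp_logsq_sub_logpow4_le` — `exp(K log²β − q log⁴β) ≤ C·(β^{-1})^m` eventually (`q, C > 0`);
* `eventually_btM0_le_B` — `βM₀ ≤ (14|E| + 100N_P + 1)·log²β` eventually, for every radius `0 ≤ r ≤ β^{-1/2}ℓ`;
* ★ `eventually_btMnt_ge_B` (`log⁴β/4 ≤ β·m_nt`), ★ `eventually_btMfar_ge_B` (`∃ q > 0, q·log⁴β ≤ β·m_far`), `eventually_logpow4_le_mul_powScale` (`log⁴β ≤ β·β^{-2s}`, `s < 1/2`);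
* ★★ `eventually_budget_B` — ALL SIX conjuncts of the budget hypothesis of `…BTProfileAssembly.profile_hT_of_eventually` on schedule B.
HONEST FRAMING: a stub of a child of the CONDITIONAL reduction route R2b1; C4-CORE OPEN ((B-ST), (B-OD)); not infinite volume, not a gap, not Clay.
-/

set_option autoImplicit false

noncomputable section

open MeasureTheory Filter Topology Real Asymptotics
open scoped BigOperators
open Literature.MathematicalPhysics.QuantumFieldTheory
open Literature.MathematicalPhysics.QuantumLattice

namespace Summit.QuantumFields.YangMills.Theorems.FemtoTransferGap.TwoLattice.ConstTube

open Summit.QuantumFields.YangMills.Theorems.FemtoTransferGap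
open Summit.QuantumFields.YangMills.Theorems.FemtoTransferGap.TwoLattice
open Summit.QuantumFields.YangMills.Theorems.FemtoTransferGap.TwoLattice.Avg
open Summit.QuantumFields.YangMills.Theorems.FemtoTransferGap.TwoLattice.Stiff (LinkSpace)
open Summit.QuantumFields.YangMills.Theorems.FemtoTransferGap.TwoLattice.Cov

variable {L : ℕ} [NeZero L]

/-! ## §1 The generic comparison `exp(K log²β − q log⁴β) ≤ C β^{-m}` -/

omit [NeZero L] in
/-- `exp(K·log²β − q·log⁴β) ≤ C·(β^{-1})^m` eventually, for `q, C > 0`. [folklore] -/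
theorem eventually_exp_logsq_sub_logpow4_le {K q C : ℝ} (hq : 0 < q) (hC : 0 < C) (m : ℕ) :
    ∀ᶠ β : ℝ in atTop, Real.exp (K * Real.log β ^ 2 - q * Real.log β ^ 4) ≤ C * powScale 1 β ^ m := by
  filter_upwards [eventually_ge_atTop (1 : ℝ), eventually_ge_atTop (Real.exp (max 1 ((m + |K| + |Real.log C|) / q)))] with β hβ1 hβT
  have hβ0 : 0 < β := by linarith
  have htT : max 1 ((m + |K| + |Real.log C|) / q) ≤ Real.log β := by
    rw [← Real.log_exp (max 1 _)]; exact Real.log_le_log (Real.exp_pos _) hβT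
  set t := Real.log β with ht
  have ht1 : 1 ≤ t := le_trans (le_max_left _ _) htT
  have ht2 : t ≤ t ^ 2 := by nlinarith
  have ht20 : 0 ≤ t ^ 2 := sq_nonneg t
  have hqt : (m : ℝ) + |K| + |Real.log C| ≤ q * t ^ 2 := by
    have := le_trans (le_max_right _ _) htT
    rw [div_le_iff₀ hq] at this; nlinarith
  have hy : powScale 1 β = Real.exp (-t) := by
    rw [powScale_eq hβ1, Real.rpow_neg_one, ht, Real.exp_neg, Real.exp_log hβ0]
  have hCe : C = Real.exp (Real.log C) := (Real.exp_log hC).symm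
  rw [hy, ← Real.exp_nat_mul, hCe, ← Real.exp_add, Real.exp_le_exp]
  have h1 : ((m : ℝ) + |K| + |Real.log C|) * t ^ 2 ≤ q * t ^ 2 * t ^ 2 := mul_le_mul_of_nonneg_right hqt ht20
  have hKt : K * t ^ 2 ≤ |K| * t ^ 2 := mul_le_mul_of_nonneg_right (le_abs_self K) ht20
  have hm0 : (0 : ℝ) ≤ m := Nat.cast_nonneg m
  have hmt : (m : ℝ) * t ≤ m * t ^ 2 := mul_le_mul_of_nonneg_left ht2 hm0
  have hlc : |Real.log C| ≤ |Real.log C| * t ^ 2 := le_mul_of_one_le_right (abs_nonneg _) (by nlinarith)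
  have hC' := neg_abs_le (Real.log C)
  have hsq : q * t ^ 4 = q * t ^ 2 * t ^ 2 := by ring
  rw [hsq]; linarith

/-! ## §2 The tail exponent on schedule B -/

/-- Eventually `βM₀ ≤ (14|E| + 100N_P + 1)·log²β` for every radius `0 ≤ r ≤ β^{-1/2}ℓ`. [folklore] -/
theorem eventually_btM0_le_B {r : ℝ → ℝ} (hr : ∀ β, 0 ≤ r β ∧ r β ≤ powScale (1 / 2) β * btLog β) : ∀ᶠ β : ℝ in atTop,
    β * ((Fintype.card (Edge 3 L) : ℝ) * (2 * (btEps β / 3) + 2 * Real.sqrt 2 * r β) ^ 2) +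
        β * ((10 * Real.sqrt (Fintype.card (Plaquette 3 L × Fin 3)) * r β) ^ 2 + stepActionErr (L := L) (r β) 0) ≤
      (14 * Fintype.card (Edge 3 L) + 100 * Fintype.card (Plaquette 3 L × Fin 3) + 1) * Real.log β ^ 2 := by
  have hE : (0 : ℝ) ≤ Fintype.card (Edge 3 L) := Nat.cast_nonneg _
  have hNP : (0 : ℝ) ≤ Fintype.card (Plaquette 3 L × Fin 3) := Nat.cast_nonneg _
  have hNpl : (0 : ℝ) ≤ Fintype.card (Plaquette 3 L) := Nat.cast_nonneg _
  have t4 := (tendsto_powScale_mul_btLog_pow (show (0 : ℝ) < 1 / 2 by norm_num) 4).const_mul (729945 * (Fintype.card (Plaquette 3 L) : ℝ))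
  rw [mul_zero] at t4
  filter_upwards [eventually_ge_atTop (1 : ℝ), eventually_btLog_eq, t4.eventually (eventually_le_nhds one_pos)] with β hβ1 hℓeq h4
  have hr0 := (hr β).1
  have hrx := (hr β).2
  set x := powScale (1 / 2) β with hxdef
  set ℓ := btLog β with hℓdef
  set E := (Fintype.card (Edge 3 L) : ℝ)
  set NP := (Fintype.card (Plaquette 3 L × Fin 3) : ℝ)
  set Npl := (Fintype.card (Plaquette 3 L) : ℝ)
  rw [← hℓeq]
  have hβ0 : 0 ≤ β := by linarith
  have hx0 : 0 < x := powScale_pos _ _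
  have hx1 : x ≤ 1 := powScale_le_one (by norm_num) β
  have hℓ1 : 1 ≤ ℓ := one_le_btLog β
  have hℓ0 : 0 ≤ ℓ := by linarith
  have hl2 : 1 ≤ ℓ ^ 2 := one_le_pow₀ hℓ1
  have hβx : β * x ^ 2 = 1 := mul_powScale_half_sq hβ1
  have hεx : btEps β ≤ x := by unfold btEps; exact powScale_le_powScale (by norm_num) β
  have hεxl : btEps β ≤ x * ℓ := hεx.trans (le_mul_of_one_le_right hx0.le hℓ1)
  have hε0 : 0 ≤ btEps β := (btEps_pos_le β).1.le
  have h2 : Real.sqrt 2 ≤ 3 / 2 := by rw [Real.sqrt_le_left (by norm_num)]; norm_num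
  have hs20 : 0 ≤ Real.sqrt 2 := Real.sqrt_nonneg _
  have hxl0 : 0 ≤ x * ℓ := by positivity
  -- term 1
  have t1 : β * (E * (2 * (btEps β / 3) + 2 * Real.sqrt 2 * r β) ^ 2) ≤ 14 * E * ℓ ^ 2 := by
    have e2x : Real.sqrt 2 * r β ≤ 3 / 2 * (x * ℓ) := mul_le_mul h2 hrx hr0 (by norm_num)
    have hin : 2 * (btEps β / 3) + 2 * Real.sqrt 2 * r β ≤ 11 / 3 * (x * ℓ) := by linarith
    have hin0 : 0 ≤ 2 * (btEps β / 3) + 2 * Real.sqrt 2 * r β := by positivity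
    have hsq : (2 * (btEps β / 3) + 2 * Real.sqrt 2 * r β) ^ 2 ≤ (11 / 3 * (x * ℓ)) ^ 2 := pow_le_pow_left₀ hin0 hin 2
    calc β * (E * (2 * (btEps β / 3) + 2 * Real.sqrt 2 * r β) ^ 2) ≤ β * (E * (11 / 3 * (x * ℓ)) ^ 2) := by gcongr
      _ = 121 / 9 * E * ℓ ^ 2 * (β * x ^ 2) := by ring
      _ ≤ 14 * E * ℓ ^ 2 := by rw [hβx, mul_one]; nlinarith
  -- term 2
  have hsqNP : Real.sqrt NP ^ 2 = NP := Real.sq_sqrt hNP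
  have t2 : β * (10 * Real.sqrt NP * r β) ^ 2 ≤ 100 * NP * ℓ ^ 2 := by
    have hq := pow_le_pow_left₀ hr0 hrx 2
    calc β * (10 * Real.sqrt NP * r β) ^ 2 = 100 * Real.sqrt NP ^ 2 * (β * r β ^ 2) := by ring
      _ ≤ 100 * Real.sqrt NP ^ 2 * (β * (x * ℓ) ^ 2) := by gcongr
      _ = 100 * NP * ℓ ^ 2 * (β * x ^ 2) := by rw [hsqNP]; ring
      _ = 100 * NP * ℓ ^ 2 := by rw [hβx, mul_one]
  -- term 3
  have t3 : β * stepActionErr (L := L) (r β) 0 ≤ 1 := by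
    unfold stepActionErr
    rw [Real.sqrt_zero]
    have h3 : r β ^ 3 ≤ (x * ℓ) ^ 3 := pow_le_pow_left₀ hr0 hrx 3
    have h4' : r β ^ 4 ≤ (x * ℓ) ^ 4 := pow_le_pow_left₀ hr0 hrx 4
    have hx2 : x ^ 2 ≤ x := by nlinarith
    have hβr3 : β * r β ^ 3 ≤ x * ℓ ^ 3 := by
      calc β * r β ^ 3 ≤ β * (x * ℓ) ^ 3 := mul_le_mul_of_nonneg_left h3 hβ0
        _ = x * ℓ ^ 3 * (β * x ^ 2) := by ring
        _ = x * ℓ ^ 3 := by rw [hβx, mul_one]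
    have hβr4 : β * r β ^ 4 ≤ x * ℓ ^ 4 := by
      calc β * r β ^ 4 ≤ β * (x * ℓ) ^ 4 := mul_le_mul_of_nonneg_left h4' hβ0
        _ = x ^ 2 * ℓ ^ 4 * (β * x ^ 2) := by ring
        _ = x ^ 2 * ℓ ^ 4 := by rw [hβx, mul_one]
        _ ≤ x * ℓ ^ 4 := mul_le_mul_of_nonneg_right hx2 (by positivity)
    have hl34 : x * ℓ ^ 3 ≤ x * ℓ ^ 4 := mul_le_mul_of_nonneg_left (pow_le_pow_right₀ hℓ1 (by norm_num)) hx0.le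
    have e : β * (Npl * (1728 * r β ^ 2 * 0 + 29376 * r β ^ 3 + 700569 * r β ^ 4)) = Npl * (29376 * (β * r β ^ 3) + 700569 * (β * r β ^ 4)) := by ring
    rw [e]
    have h5 : Npl * (29376 * (β * r β ^ 3) + 700569 * (β * r β ^ 4)) ≤ Npl * (729945 * (x * ℓ ^ 4)) :=
      mul_le_mul_of_nonneg_left (by linarith) hNpl
    linarith
  rw [mul_add β]
  linarith

/-! ## §3 Floors for the two defect masses on schedule B -/

/-- ★ Eventually `log⁴β/4 ≤ β·m_nt(schedule B)`: both branches of `m_nt` exceed `xℓ²/2`. [folklore] -/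
theorem eventually_btMnt_ge_B {s : ℝ} (hs : 0 < s) (hs2 : s < 1 / 2) {r : ℝ → ℝ} (hr : ∀ β, 0 ≤ r β ∧ r β ≤ powScale (1 / 2) β * btLog β) :
    ∀ᶠ β : ℝ in atTop, Real.log β ^ 4 / 4 ≤
      β * btMnt L (recordDelta1 L s β) (powScale (1 / 2) β * btLog β ^ 2) (r β) (5 * (powScale (1 / 2) β * btLog β ^ 2)) (btEps β) := by
  have hL1 : (1 : ℝ) ≤ L := by exact_mod_cast NeZero.one_le
  have hL0 : (0 : ℝ) < L := by linarith
  have hN : (0 : ℝ) < Fintype.card (Site 3 L) := by exact_mod_cast Fintype.card_pos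
  have hc : (0 : ℝ) < 1 / (60 * L) := by positivity
  filter_upwards [eventually_schedule_facts (L := L) hs hs2, eventually_ge_atTop (Real.exp 14),
    (tendsto_powScale_mul_btLog_pow (show (0 : ℝ) < 1 / 2 by norm_num) 2).eventually (eventually_le_nhds hc),
    (tendsto_powScale_mul_btLog_pow (show (0 : ℝ) < 1 / 2 by norm_num) 1).eventually (eventually_le_nhds hc)] with β hf hβ14 hxl2 hxl1
  obtain ⟨hβ1, hℓeq, -, -, hεx, -, -, -, hδs, -, hδhalf⟩ := hf
  rw [pow_one] at hxl1
  have hℓ14 : 14 ≤ Real.log β := by rw [← Real.log_exp 14]; exact Real.log_le_log (Real.exp_pos _) hβ14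
  have hr0 := (hr β).1
  have hrx := (hr β).2
  set x := powScale (1 / 2) β with hxdef
  set δ := recordDelta1 L s β with hδdef
  rw [← hℓeq]
  rw [← hℓeq] at hℓ14
  set ℓ := btLog β with hℓdef
  have hx0 : 0 < x := powScale_pos _ _
  have hx1 : x ≤ 1 := powScale_le_one (by norm_num) β
  have hℓ0 : 0 ≤ ℓ := by linarith
  have hδ0 : 0 ≤ δ := by rw [hδdef]; unfold recordDelta1; exact div_nonneg (mul_nonneg (by norm_num) (powScale_pos _ _).le) hN.le
  have hε0 : 0 ≤ btEps β := (btEps_pos_le β).1.le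
  have hβx : β * x ^ 2 = 1 := mul_powScale_half_sq hβ1
  have h2 : Real.sqrt 2 ≤ 3 / 2 := by rw [Real.sqrt_le_left (by norm_num)]; norm_num
  have hs20 : 0 ≤ Real.sqrt 2 := Real.sqrt_nonneg _
  have hxl0 : 0 ≤ x * ℓ := by positivity
  have h60 : (1 : ℝ) / (60 * L) ≤ 1 := by rw [div_le_one (by positivity)]; linarith
  have hxl1' : x * ℓ ≤ 1 := hxl1.trans h60
  have hxl20 : 0 ≤ x * ℓ ^ 2 / 2 := by positivity
  have e2r : Real.sqrt 2 * r β ≤ 3 / 2 * (x * ℓ) := mul_le_mul h2 hrx hr0 (by norm_num)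
  have hkey : (x * ℓ ^ 2 / 2) ^ 2 ≤ btMnt L δ (x * ℓ ^ 2) (r β) (5 * (x * ℓ ^ 2)) (btEps β) := by
    refine btMnt_ge_sq (L := L) hxl20 ?_ ?_
    · -- `2.5xℓ² − 2(√2 r + δ)ε − 2√2 r − xℓ² ≥ xℓ²/2`
      have e1 : 2 * (Real.sqrt 2 * r β + δ) * btEps β ≤ 4 * (x * ℓ) := by
        have h3 : Real.sqrt 2 * r β + δ ≤ 3 / 2 * (x * ℓ) + 1 / 2 := by linarith
        have hεxl : btEps β ≤ x * ℓ := hεx.trans (le_mul_of_one_le_right hx0.le (by linarith))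
        have h4 : 2 * (Real.sqrt 2 * r β + δ) * btEps β ≤ 2 * (3 / 2 * (x * ℓ) + 1 / 2) * (x * ℓ) :=
          mul_le_mul (by linarith) hεxl hε0 (by positivity)
        have h5 : (x * ℓ) * (x * ℓ) ≤ 1 * (x * ℓ) := mul_le_mul_of_nonneg_right hxl1' hxl0
        have h6 : 2 * (3 / 2 * (x * ℓ) + 1 / 2) * (x * ℓ) = 3 * ((x * ℓ) * (x * ℓ)) + x * ℓ := by ring
        linarith
      have e3 : x * ℓ * 14 ≤ x * ℓ * ℓ := mul_le_mul_of_nonneg_left hℓ14 hxl0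
      have e4 : x * ℓ ^ 2 = x * ℓ * ℓ := by ring
      linarith
    · -- `1/(3L) − 4(√2 r + δ) − (2√2 r + xℓ²) ≥ xℓ²/2`
      have hu4000 : (1 : ℝ) / (4000 * L) = 1 / (3 * L) * (3 / 4000) := by ring
      have hu60 : (1 : ℝ) / (60 * L) = 1 / (3 * L) / 20 := by ring
      have hu0 : (0 : ℝ) < 1 / (3 * L) := by positivity
      rw [hu4000] at hδs
      rw [hu60] at hxl2 hxl1
      linarith
  calc ℓ ^ 4 / 4 = β * (x * ℓ ^ 2 / 2) ^ 2 := by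
        have : β * (x * ℓ ^ 2 / 2) ^ 2 = ℓ ^ 4 / 4 * (β * x ^ 2) := by ring
        rw [this, hβx, mul_one]
    _ ≤ _ := mul_le_mul_of_nonneg_left hkey (by linarith)

/-- Eventually `log⁴β ≤ β·β^{-2s}` (`s < 1/2`). [folklore] -/
theorem eventually_logpow4_le_mul_powScale {s : ℝ} (hs2 : s < 1 / 2) : ∀ᶠ β : ℝ in atTop, Real.log β ^ 4 ≤ β * powScale (2 * s) β := by
  have h := (isLittleO_log_rpow_rpow_atTop 4 (show (0 : ℝ) < 1 - 2 * s by linarith)).bound (show (0 : ℝ) < 1 by norm_num)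
  filter_upwards [h, eventually_ge_atTop (1 : ℝ)] with β hb hβ1
  have hβ0 : 0 < β := by linarith
  have e4 : Real.log β ^ (4 : ℝ) = Real.log β ^ 4 := by rw [show (4 : ℝ) = ((4 : ℕ) : ℝ) by norm_num, Real.rpow_natCast]
  rw [one_mul, Real.norm_eq_abs, Real.norm_eq_abs, e4, abs_of_nonneg (by positivity), abs_of_nonneg (Real.rpow_nonneg hβ0.le _)] at hb
  have e : β * powScale (2 * s) β = β ^ (1 - 2 * s) := by
    rw [powScale_eq hβ1, show (1 : ℝ) - 2 * s = 1 + -(2 * s) by ring, Real.rpow_add hβ0, Real.rpow_one]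
  rw [e]; exact hb

/-- ★ Eventually `q_L·log⁴β ≤ β·m_far(schedule B)` for some `q_L > 0`. [folklore] -/
theorem eventually_btMfar_ge_B {s : ℝ} (hs : 0 < s) (hs2 : s < 1 / 2) {r : ℝ → ℝ} (hr : ∀ β, 0 ≤ r β ∧ r β ≤ powScale (1 / 2) β * btLog β) :
    ∃ q : ℝ, 0 < q ∧ ∀ᶠ β : ℝ in atTop, q * Real.log β ^ 4 ≤
      β * btMfar L (recordDelta1 L s β) (powScale (1 / 2) β * btLog β ^ 2) (r β) (btEps β) (13 * recordDelta1 L s β) := by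
  have hL1 : (1 : ℝ) ≤ L := by exact_mod_cast NeZero.one_le
  have hL0 : (0 : ℝ) < L := by linarith
  have hN : (0 : ℝ) < Fintype.card (Site 3 L) := by exact_mod_cast Fintype.card_pos
  have hN1 : (1 : ℝ) ≤ Fintype.card (Site 3 L) := by exact_mod_cast Fintype.card_pos
  have hE : (0 : ℝ) < Fintype.card (Edge 3 L) := by exact_mod_cast Fintype.card_pos
  set q : ℝ := min (36 * 196 / (Fintype.card (Site 3 L) : ℝ) ^ 2) ((Fintype.card (Site 3 L) : ℝ) ^ 2 / (16 * Fintype.card (Edge 3 L))) with hqdef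
  refine ⟨q, lt_min (by positivity) (by positivity), ?_⟩
  have hs2' : (0 : ℝ) < 1 / 2 - s := by linarith
  filter_upwards [eventually_schedule_facts (L := L) hs hs2, eventually_ge_atTop (Real.exp 14), eventually_logpow4_le_mul_powScale hs2,
    (tendsto_powScale_mul_btLog_pow hs2' 1).eventually (eventually_le_nhds (show (0 : ℝ) < 14 / (9 * Fintype.card (Site 3 L)) by positivity)),
    (tendsto_powScale_mul_btLog_pow (show (0 : ℝ) < 1 / 2 by norm_num) 2).eventually (eventually_le_nhds one_pos)] with β hf hβ14 hlog hsmall hxl2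
  obtain ⟨hβ1, hℓeq, -, -, hεx, hxδ, -, -, hδs, hεs, hδhalf⟩ := hf
  rw [pow_one] at hsmall
  have hℓ14 : 14 ≤ Real.log β := by rw [← Real.log_exp 14]; exact Real.log_le_log (Real.exp_pos _) hβ14
  rw [← hℓeq] at hℓ14 ⊢
  rw [← hℓeq] at hlog
  have hr0 := (hr β).1
  have hrx := (hr β).2
  set x := powScale (1 / 2) β with hxdef
  set δ := recordDelta1 L s β with hδdef
  set ℓ := btLog β with hℓdef
  set N := (Fintype.card (Site 3 L) : ℝ) with hNdef
  have hβ0 : 0 < β := by linarith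
  have hx0 : 0 < x := powScale_pos _ _
  have hx1 : x ≤ 1 := powScale_le_one (by norm_num) β
  have hℓ0 : 0 ≤ ℓ := by linarith
  have hδ0 : 0 ≤ δ := by rw [hδdef]; unfold recordDelta1; exact div_nonneg (mul_nonneg (by norm_num) (powScale_pos _ _).le) hN.le
  have hε0 : 0 ≤ btEps β := (btEps_pos_le β).1.le
  have hβx : β * x ^ 2 = 1 := mul_powScale_half_sq hβ1
  have h2 : Real.sqrt 2 ≤ 3 / 2 := by rw [Real.sqrt_le_left (by norm_num)]; norm_num
  have hs20 : 0 ≤ Real.sqrt 2 := Real.sqrt_nonneg _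
  have hxl0 : 0 ≤ x * ℓ := by positivity
  have hLδ : (L : ℝ) * δ < 1 / 4000 := by
    have := mul_lt_mul_of_pos_left hδs hL0; rwa [show (L : ℝ) * (1 / (4000 * L)) = 1 / 4000 by field_simp] at this
  -- `9xℓ ≤ δ`: `xℓ = β^{-(1/2-s)}ℓ · β^{-s}` and `δ = 14β^{-s}/N`
  have hx9 : 9 * (x * ℓ) ≤ δ := by
    have e : x * ℓ = powScale (1 / 2 - s) β * ℓ * powScale s β := by
      rw [hxdef, powScale_eq hβ1, powScale_eq hβ1, powScale_eq hβ1]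
      rw [show -(1 / 2 : ℝ) = -(1 / 2 - s) + -s by ring, Real.rpow_add hβ0]; ring
    have hδeq : δ = 14 * powScale s β / N := rfl
    rw [e, hδeq, le_div_iff₀ hN]
    have hp := powScale_pos s β
    have hsmall' : powScale (1 / 2 - s) β * ℓ * (9 * N) ≤ 14 := by rwa [le_div_iff₀ (by positivity)] at hsmall
    calc 9 * (powScale (1 / 2 - s) β * ℓ * powScale s β) * N = (powScale (1 / 2 - s) β * ℓ * (9 * N)) * powScale s β := by ring
      _ ≤ 14 * powScale s β := mul_le_mul_of_nonneg_right hsmall' hp.le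
  -- the two branches
  have hm₁ : 6 * δ ≤ 13 * δ - 4 * (Real.sqrt 2 * r β + δ) - (2 * Real.sqrt 2 * r β + 2 * δ) := by
    have e2r : Real.sqrt 2 * r β ≤ 3 / 2 * (x * ℓ) := mul_le_mul h2 hrx hr0 (by norm_num)
    linarith
  have hm₂ : N * (x * ℓ ^ 2) / 4 ≤ N * (1 - 3 * L * (13 * δ)) * (x * ℓ ^ 2) -
      (2 * btEps β * N * δ + 2 * r β ^ 2 + 2 * Real.sqrt 2 * N * (9 * L * (13 * δ) + btEps β) * r β) := by
    have hxℓ20 : 0 ≤ x * ℓ ^ 2 := by positivity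
    have hNx : 0 ≤ N * x := by positivity
    have h39 : 1 / 2 ≤ 1 - 3 * (L : ℝ) * (13 * δ) := by linarith
    have hsig : N * (1 / 2) * (x * ℓ ^ 2) ≤ N * (1 - 3 * L * (13 * δ)) * (x * ℓ ^ 2) := by gcongr
    have j1 : 2 * btEps β * N * δ ≤ N * x := by
      have h := mul_le_mul hεx hδhalf hδ0 hx0.le
      have := mul_le_mul_of_nonneg_left h (by positivity : (0 : ℝ) ≤ 2 * N)
      have e : 2 * N * (btEps β * δ) = 2 * btEps β * N * δ := by ring
      have e' : 2 * N * (x * (1 / 2)) = N * x := by ring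
      linarith
    have j2 : 2 * r β ^ 2 ≤ 2 * (N * x) := by
      have hq := pow_le_pow_left₀ hr0 hrx 2
      have h' : x ≤ N * x := le_mul_of_one_le_left hx0.le hN1
      have h5 : (x * ℓ) ^ 2 = (x * ℓ ^ 2) * x := by ring
      have h6 : (x * ℓ ^ 2) * x ≤ 1 * x := mul_le_mul_of_nonneg_right hxl2 hx0.le
      nlinarith
    have j3 : 2 * Real.sqrt 2 * N * (9 * L * (13 * δ) + btEps β) * r β ≤ 3 * (31 / 1000) * (N * (x * ℓ)) := by
      have hin : 9 * (L : ℝ) * (13 * δ) + btEps β ≤ 31 / 1000 := by linarith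
      have hin0 : 0 ≤ 9 * (L : ℝ) * (13 * δ) + btEps β := by positivity
      have h22 : 2 * Real.sqrt 2 ≤ 3 := by linarith
      calc 2 * Real.sqrt 2 * N * (9 * L * (13 * δ) + btEps β) * r β = 2 * Real.sqrt 2 * (9 * L * (13 * δ) + btEps β) * (N * r β) := by ring
        _ ≤ 3 * (31 / 1000) * (N * (x * ℓ)) :=
            mul_le_mul (mul_le_mul h22 hin hin0 (by norm_num)) (mul_le_mul_of_nonneg_left hrx hN.le) (by positivity) (by norm_num)
    have hℓN : N * x * 14 ≤ N * x * ℓ := mul_le_mul_of_nonneg_left hℓ14 hNx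
    have hℓN2 : N * (x * ℓ) * 14 ≤ N * (x * ℓ) * ℓ := mul_le_mul_of_nonneg_left hℓ14 (by positivity)
    linarith
  have hfloor := btMfar_ge_min (L := L) (by positivity : (0 : ℝ) ≤ 6 * δ) (by positivity : 0 ≤ N * (x * ℓ ^ 2) / 4) hm₁ hm₂
  have hq1 : q * ℓ ^ 4 ≤ β * (6 * δ) ^ 2 := by
    have hδeq : δ = 14 * powScale s β / N := rfl
    have hp2 : powScale s β ^ 2 = powScale (2 * s) β := by
      rw [powScale_eq hβ1, powScale_eq hβ1, ← Real.rpow_mul_natCast hβ0.le]; congr 1; push_cast; ring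
    have e : β * (6 * δ) ^ 2 = 36 * 196 / N ^ 2 * (β * powScale (2 * s) β) := by rw [hδeq, ← hp2]; ring
    rw [e]
    calc q * ℓ ^ 4 ≤ 36 * 196 / N ^ 2 * ℓ ^ 4 := mul_le_mul_of_nonneg_right (min_le_left _ _) (by positivity)
      _ ≤ 36 * 196 / N ^ 2 * (β * powScale (2 * s) β) := mul_le_mul_of_nonneg_left hlog (by positivity)
  have hq2 : q * ℓ ^ 4 ≤ β * ((N * (x * ℓ ^ 2) / 4) ^ 2 / Fintype.card (Edge 3 L)) := by
    have e : β * ((N * (x * ℓ ^ 2) / 4) ^ 2 / Fintype.card (Edge 3 L)) = N ^ 2 / (16 * Fintype.card (Edge 3 L)) * ℓ ^ 4 * (β * x ^ 2) := by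
      ring
    rw [e, hβx, mul_one]
    exact mul_le_mul_of_nonneg_right (min_le_right _ _) (by positivity)
  calc q * ℓ ^ 4 ≤ β * min ((6 * δ) ^ 2) ((N * (x * ℓ ^ 2) / 4) ^ 2 / Fintype.card (Edge 3 L)) := by
        rw [mul_min_of_nonneg _ _ hβ0.le]; exact le_min hq1 hq2
    _ ≤ _ := mul_le_mul_of_nonneg_left hfloor hβ0.le

/-! ## §4 ★★ The budget hypothesis on schedule B, eventually -/

/-- ★★ **ALL SIX conjuncts of the budget hypothesis on schedule B**, eventually (`0 < s < 1/2`, any radius `0 ≤ r ≤ β^{-1/2}ℓ`). [folklore] -/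
theorem eventually_budget_B {s : ℝ} (hs : 0 < s) (hs2 : s < 1 / 2) {r : ℝ → ℝ} (hr : ∀ β, 0 ≤ r β ∧ r β ≤ powScale (1 / 2) β * btLog β) :
    ∀ᶠ β : ℝ in atTop, 1 ≤ (L : ℝ) ^ 3 * β ∧ 2 / rStar ^ 3 ≤ (L : ℝ) ^ 3 * β ∧ 2 * (btEps β / 3) < 5 * (powScale (1 / 2) β * btLog β ^ 2) ∧
      Real.exp (β * ((Fintype.card (Edge 3 L) : ℝ) * (2 * (btEps β / 3) + 2 * Real.sqrt 2 * r β) ^ 2) +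
            β * ((10 * Real.sqrt (Fintype.card (Plaquette 3 L × Fin 3)) * r β) ^ 2 + stepActionErr (L := L) (r β) 0)) *
          Real.exp (-(β * btMnt L (recordDelta1 L s β) (powScale (1 / 2) β * btLog β ^ 2) (r β) (5 * (powScale (1 / 2) β * btLog β ^ 2)) (btEps β))) ≤
        powScale 1 β / 3 * (gaugeMeasure L).real (gaugeCore L (btEps β / 3)) * (Real.exp (-3) * ((L : ℝ) ^ 3 * β) ^ (-(9 : ℝ) / 2) / 2000) ∧
      Real.exp (β * ((Fintype.card (Edge 3 L) : ℝ) * (2 * (btEps β / 3) + 2 * Real.sqrt 2 * r β) ^ 2) +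
            β * ((10 * Real.sqrt (Fintype.card (Plaquette 3 L × Fin 3)) * r β) ^ 2 + stepActionErr (L := L) (r β) 0)) *
          Real.exp (-(β * btMfar L (recordDelta1 L s β) (powScale (1 / 2) β * btLog β ^ 2) (r β) (btEps β) (13 * recordDelta1 L s β))) ≤
        powScale 1 β / 3 * (gaugeMeasure L).real (gaugeCore L (btEps β / 3)) * (Real.exp (-3) * ((L : ℝ) ^ 3 * β) ^ (-(9 : ℝ) / 2) / 2000) ∧
      Real.exp (-((L : ℝ) ^ 3 * β * (powScale (1 / 2) β * btLog β ^ 2) ^ 2)) ≤ powScale 1 β / 3 * (Real.exp (-3) * ((L : ℝ) ^ 3 * β) ^ (-(9 : ℝ) / 2) / 2000) := by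
  have hL1 : (1 : ℝ) ≤ L := by exact_mod_cast NeZero.one_le
  have hL0 : (0 : ℝ) < L := by linarith
  have hL3 : (1 : ℝ) ≤ (L : ℝ) ^ 3 := one_le_pow₀ hL1
  set K : ℝ := 14 * Fintype.card (Edge 3 L) + 100 * Fintype.card (Plaquette 3 L × Fin 3) + 1 with hKdef
  obtain ⟨C₁, hC₁, hrhs⟩ := budget_rhs_ge (L := L)
  obtain ⟨q, hq, hfar⟩ := eventually_btMfar_ge_B (L := L) hs hs2 hr
  have hC₃ : 0 < Real.exp (-3) * ((L : ℝ) ^ 3) ^ (-(9 : ℝ) / 2) / 6000 := by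
    have : 0 < ((L : ℝ) ^ 3) ^ (-(9 : ℝ) / 2) := Real.rpow_pos_of_pos (by positivity) _
    positivity
  filter_upwards [eventually_budget_elementary (L := L), eventually_btM0_le_B (L := L) hr, eventually_btMnt_ge_B (L := L) hs hs2 hr, hfar,
    eventually_exp_logsq_sub_logpow4_le (K := K) (show (0 : ℝ) < 1 / 4 by norm_num) hC₁ (3 * Fintype.card (Site 3 L) + 6),
    eventually_exp_logsq_sub_logpow4_le (K := K) hq hC₁ (3 * Fintype.card (Site 3 L) + 6),
    eventually_exp_logsq_sub_logpow4_le (K := 0) one_pos hC₃ 6, eventually_ge_atTop (1 : ℝ), eventually_btLog_eq] with β hel hM hnt hfarβ hg1 hg2 hg3 hβ1 hℓeq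
  obtain ⟨hB1, hB2, -⟩ := hel
  have hrhsβ := hrhs β hβ1
  have hrhs' := budget_rhs_ge' (L := L) hβ1
  have hx0 : 0 < powScale (1 / 2) β := powScale_pos _ _
  have hl2 : 1 ≤ btLog β ^ 2 := one_le_pow₀ (one_le_btLog β)
  refine ⟨hB1, hB2, ?_, ?_, ?_, ?_⟩
  · have hεx : btEps β ≤ powScale (1 / 2) β := powScale_le_powScale (by norm_num) β
    have : powScale (1 / 2) β ≤ powScale (1 / 2) β * btLog β ^ 2 := le_mul_of_one_le_right hx0.le hl2
    linarith
  · calc _ ≤ Real.exp (K * Real.log β ^ 2) * Real.exp (-(Real.log β ^ 4 / 4)) :=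
          mul_le_mul (Real.exp_le_exp.mpr hM) (Real.exp_le_exp.mpr (by linarith)) (Real.exp_pos _).le (Real.exp_pos _).le
      _ = Real.exp (K * Real.log β ^ 2 - 1 / 4 * Real.log β ^ 4) := by rw [← Real.exp_add]; congr 1; ring
      _ ≤ _ := hg1.trans hrhsβ
  · calc _ ≤ Real.exp (K * Real.log β ^ 2) * Real.exp (-(q * Real.log β ^ 4)) :=
          mul_le_mul (Real.exp_le_exp.mpr hM) (Real.exp_le_exp.mpr (by linarith)) (Real.exp_pos _).le (Real.exp_pos _).le
      _ = Real.exp (K * Real.log β ^ 2 - q * Real.log β ^ 4) := by rw [← Real.exp_add, sub_eq_add_neg]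
      _ ≤ _ := hg2.trans hrhsβ
  · have hβx : β * powScale (1 / 2) β ^ 2 = 1 := mul_powScale_half_sq hβ1
    have hα : (L : ℝ) ^ 3 * β * (powScale (1 / 2) β * btLog β ^ 2) ^ 2 = (L : ℝ) ^ 3 * Real.log β ^ 4 := by
      rw [hℓeq]
      calc (L : ℝ) ^ 3 * β * (powScale (1 / 2) β * Real.log β ^ 2) ^ 2 = (L : ℝ) ^ 3 * Real.log β ^ 4 * (β * powScale (1 / 2) β ^ 2) := by ring
        _ = (L : ℝ) ^ 3 * Real.log β ^ 4 := by rw [hβx, mul_one]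
    have hge : Real.log β ^ 4 ≤ (L : ℝ) ^ 3 * β * (powScale (1 / 2) β * btLog β ^ 2) ^ 2 := by
      rw [hα]; exact le_mul_of_one_le_left (by positivity) hL3
    calc Real.exp (-((L : ℝ) ^ 3 * β * (powScale (1 / 2) β * btLog β ^ 2) ^ 2)) ≤ Real.exp (0 * Real.log β ^ 2 - 1 * Real.log β ^ 4) :=
          Real.exp_le_exp.mpr (by linarith)
      _ ≤ _ := hg3.trans hrhs'

end Summit.QuantumFields.YangMills.Theorems.FemtoTransferGap.TwoLattice.ConstTube

end
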